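import Summits.MatrixMultiplication.OmegaCensus.STPPKernelBitsets

/-!
# ω-census (abelian STPP census): the cell-(2,2) checkers for the fifth leaf `{(2,2,2),(3,3,3)²} @ ℤ₆₁` (tool file, definitions only)

HONEST FRAMING (pub-omega census; verbatim): lottery ticket; floor = certified bounds/negative ranges.
Census STRUCTURE (seat pub-omega-stpp-1 gen 33, 2026-08-29), family (b2).  In the slack-4 cell `(δ₁, δ₂′) = (2,2)` of the law
`no_isSTPP_of_slack_four_tables_of_cell22` (`STPPVosperSlackFourLawT.lean`) both pairs `(−Aᵢ, Y°)` and `(−Bᵢ, Z°)` are `(3,13)`-pairs TWO above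
Cauchy–Davenport at `p = 61`, so the two-above zoo (`zoo313_61_of_rows`, `STPPZoo313Theorem.lean`; table `zooTbl61`) applies to both, and
`ℤ/61 = (Cᵢ + X) ⊔ S₁ ⊔ T` with `S₁ = {0,1,y} + Y°`, `T = w·({0,1,y′} + Y″) + s`, `X = {0,1,y} + w·{0,1,y′}` in the normal form
`−Aᵢ = {0,1,y}`, `−Bᵢ = w·{0,1,y′}`, `Z° = w·Y″ + s` (`y, y′ ∈ {2,3,4}` after the affine renormalisation the zoo permits).  This file defines the
KERNEL side of that certificate, mirrored verbatim by HOME `pub-omega-stpp-1-g33/code/cell22c.py` (python ×1 DATUM there: 269 shapes, 4 341 660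
stage-1 tests, 3 712 569 admissible placements (622 583 pass the two closure filters), 40 exact 3-covers, 1 652 `(Y°, Z°)` realisations, all dead
under the words cover):
* `s1Mask p y m` — the mask of `{0,1,y} + set m`; `nrmMask` (translation-canonical form = least rotation), `offMask` (the rotation realising it),
  `dilMask` (dilation by a unit), `xMask` (the 9-point pattern `X`), `lowMem`, `coverK` (exact cover of `W` by `k` translates of `X`, greedy on the
  least member), `place22` / `place22Row` (stage 1: every admissible exact placement of `(σ₁, w·σ₂ + s)` is listed in `plc`; two closure pre-filters),
  `lookup22` / `real22` (stage 2: every realisation `(Y°, Z°)` of a listed placement by zoo entries is in the (grouped, mask-keyed) dead table).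
Soundness (the law consuming these rows) is NOT in this file.  Nothing here is progress on `ω`.

References: H. Cohn, R. Kleinberg, B. Szegedy, C. Umans, FOCS 2005, Def. 5.1; H. S. Warren, Hacker's Delight (2002), §2-1.
-/

namespace Summit.MatrixMultiplication.OmegaCensus.CubeNB.S2

open Summit.MatrixMultiplication.OmegaCensus.CubeNB.Bits

/-! ## §1 Shape primitives -/

/-- Mask of the sumset `{0,1,y} + set m` (modulo `p`). [folklore] -/
def s1Mask (p y m : ℕ) : ℕ := m ||| rot p m 1 ||| rot p m y

/-- Translation-canonical form of a mask: the least of its `p` rotations. [folklore] -/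
def nrmMask (p m : ℕ) : ℕ := (List.range p).foldl (fun acc t => min acc (rot p m t)) m

/-- The least rotation amount `t` with `rot p σ t = S` (`0` if none). [folklore] -/
def offMask (p σ S : ℕ) : ℕ := ((List.range p).find? fun t => Nat.beq (rot p σ t) S).getD 0

/-- Dilation of a subset of `ℤ/p` by `u`: the mask of `{v·u mod p : v ∈ set m}`. [folklore] -/
def dilMask (p m u : ℕ) : ℕ := maskOf ((members (List.range p) m).map fun v => v * u % p)

/-- The 9-point pattern `X = {0,1,y} + w·{0,1,y′}` (modulo `p`) as a mask. [folklore] -/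
def xMask (p y w y' : ℕ) : ℕ := maskOf ([0, 1, y].flatMap fun a => [0, 1, y'].map fun b => (a + w * b) % p)

/-- The least member of a mask below `p` (`0` if empty). [folklore] -/
def lowMem (p W : ℕ) : ℕ := ((List.range p).find? fun v => tb W v).getD 0

/-- **Exact cover test**: can `W` be written as a disjoint union of exactly `k` translates `r + X` (greedy: the least member of `W` is covered first;
`xs` = the members of `X`)? [folklore] -/
def coverK (p X : ℕ) (xs : List ℕ) : ℕ → ℕ → Bool
  | 0, W => Nat.beq W 0
  | k + 1, W =>
    !(Nat.beq W 0) && xs.any fun x =>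
      let m := rot p X ((lowMem p W + p - x) % p)
      Nat.beq (m &&& (fullMask p ^^^ W)) 0 && coverK p X xs k (W ^^^ m)

/-! ## §2 Stage 1: placements of two shapes -/

/-- **Stage 1 for one triple** `(σ₁; σ₂ dilated to T0 with members mT0; w)`: every translate `s` with `σ₁ ∩ (T0 + s) = ∅` whose complement
`ℤ/p ∖ (σ₁ ∪ (T0 + s))` is an exact union of 3 translates of `X = {0,1,y} + w{0,1,y′}` is listed in `plc` as `(y, σ₁, y′, σ₂, w, s)`. [folklore] -/
def place22 (p : ℕ) (plc : List (ℕ × ℕ × ℕ × ℕ × ℕ × ℕ)) (y σ₁ y' σ₂ w T0 : ℕ) (mT0 : List ℕ) : Bool :=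
  let D := mT0.foldl (fun acc t => acc ||| rot p σ₁ (p - t)) 0
  Nat.beq D (fullMask p) ||
    (let X := xMask p y w y'
     let xs := members (List.range p) X
     let wy := w * y' % p
     (members (List.range p) (fullMask p ^^^ D)).all fun s =>
       let W := fullMask p ^^^ (σ₁ ||| rot p T0 s)
       -- cheap necessary closure tests: `W` is a union of translates of `w{0,1,y′}` and of `{0,1,y}`
       let V := W &&& rot p W (p - w % p) &&& rot p W (p - wy)
       !(Nat.beq (V ||| rot p V (w % p) ||| rot p V wy) W) ||
         (let U := W &&& rot p W (p - 1) &&& rot p W (p - y)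
          !(Nat.beq (U ||| rot p U 1 ||| rot p U y) W) ||
            !(coverK p X xs 3 W) || decide ((y, σ₁, y', σ₂, w, s) ∈ plc)))

/-- **Stage 1 row**: the shape `b = (y′, σ₂)` dilated by `w` against every shape `a = (y, σ₁)` of `shp`. [folklore] -/
def place22Row (p : ℕ) (shp : List (ℕ × ℕ)) (plc : List (ℕ × ℕ × ℕ × ℕ × ℕ × ℕ)) (b : ℕ × ℕ) (w : ℕ) : Bool :=
  let T0 := dilMask p b.2 w
  let mT0 := members (List.range p) T0
  shp.all fun a => place22 p plc a.1 a.2 b.1 b.2 w T0 mT0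

/-! ## §3 Stage 2: realisations of a placement -/

/-- Lookup in the grouped dead table: is the mask pair `(mY, mZ)` listed (`tbl` = list of `(mY, [mZ, …])`)? [folklore] -/
def lookup22 (tbl : List (ℕ × List ℕ)) (mY mZ : ℕ) : Bool :=
  tbl.any fun g => Nat.beq g.1 mY && g.2.any fun z => Nat.beq z mZ

/-- **Stage 2 for one placement** `π = (y, σ₁, y′, σ₂, w, s₁)`: for every normalised zoo entry `r₁ = (y, m₁, σ₁, t₁)` and `r₂ = (y′, m₂, σ₂, t₂)`
(`σ = nrmMask (s1Mask y m)`, `t = offMask σ (s1Mask y m)`) the realisation `(Y°, Z°) = (set m₁, w·set m₂ + s)` with `s = s₁ + t₁ − w t₂`, as the MASK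
pair `(m₁, rot (dilMask m₂ w) s)`, is listed in the grouped dead table. [folklore] -/
def real22 (p : ℕ) (nz : List (ℕ × ℕ × ℕ × ℕ)) (tbl : List (ℕ × List ℕ)) (π : ℕ × ℕ × ℕ × ℕ × ℕ × ℕ) : Bool :=
  match π with
  | (y, σ₁, y', σ₂, w, s₁) =>
    nz.all fun r₁ => !(Nat.beq r₁.1 y && Nat.beq r₁.2.2.1 σ₁) ||
      nz.all fun r₂ => !(Nat.beq r₂.1 y' && Nat.beq r₂.2.2.1 σ₂) ||
        lookup22 tbl r₁.2.1 (rot p (dilMask p r₂.2.1 w) ((s₁ + r₁.2.2.2 + p * p - w * r₂.2.2.2) % p))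

/-- **Normalisation row entry test**: the zoo entry `e = (y, m)` has its `(σ, t)` listed in `nz`. [folklore] -/
def nrmListed (p : ℕ) (nz : List (ℕ × ℕ × ℕ × ℕ)) (e : ℕ × ℕ) : Bool :=
  let S := s1Mask p e.1 e.2
  let σ := nrmMask p S
  decide ((e.1, e.2, σ, offMask p σ S) ∈ nz)

end Summit.MatrixMultiplication.OmegaCensus.CubeNB.S2
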